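import Summits.Ventures.LatticeQCDFlow.Scaling.SwapGraphDilution
import Summits.Ventures.LatticeQCDFlow.Scaling.FlowLadderConjugacy

/-!
HONEST FRAMING: exact (Metropolis-corrected) sampling algorithms for lattice gauge theory; figures
of merit are autocorrelation/cost numbers at stated couplings and volumes; no continuum-physics
claim.

# FlowGraphConjugacy — CONSISTENT TRANSPORT FAMILIES ON ANY SWAP GRAPH ARE CHANGES OF COORDINATES: IF THE MAP ON EVERY
# EDGE `(i,l)` IS `L_l⁻¹∘L_i` FOR ONE FAMILY OF LEVEL BIJECTIONS `L_k` (COMPOSED ADJACENT FLOWS ARE SUCH A FAMILY), THE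
# MAP-ASSISTED EXCHANGE SCHEME IS THE IDENTITY-MAP SCHEME ON THE SAME GRAPH FOR THE PULLED-BACK LAWS `μ_k∘L_k⁻¹`, WITH
# THE SAME SPECTRAL GAP; HENCE THE DILUTION LAW OF `SwapGraphDilution` HOLDS WITH MAPS UNDER TRANSPORTED DOMINATION
# (lean-2 GEN-23, ours)

Venture-side (OURS).  Cell `lqcd-flow` (pub-lqcd), unit `pub-lqcd-lean-2-g23`, 2026-08-26.  Chapter K, file 8: the common
generalisation of `Scaling/FlowHubSchemeFloor` (I2, the star), `Scaling/FlowLadderConjugacy` (I3, the ladder) and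
`Scaling/FlowHubProposalLaw` (K4, hub lists) to an ARBITRARY edge list `e : Fin m → Fin (K+1) × Fin (K+1)`.  A family
of edge maps is CONSISTENT when it derives from level bijections `L : Fin (K+1) → Perm S` as
`φ_r = L_{l_r}⁻¹ ∘ L_{i_r}` (`e_r = (i_r, l_r)`); in the flow literature the map between two couplings is the
composition of the trained maps between the intermediate ones, which is exactly this condition.  The relabelling
`Ψ(x)_k = L_k(x_k)` then straightens every map swap into a plain swap.

## What is proved

* §1 **`levelRelabel_edgeFlowSwap`** (`Ψ(edgeFlowSwap φ_r i l x) = Ψ(x)∘τ_{il}`; the product law relabels by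
  `Scaling/FlowLadderConjugacy`'s `tensorFun_relabel`),
  **`ptGraphProposal_levelRelabel`**, **`flowGraph_apply_eq_conj`**, **`flowGraph_spectralGap_eq`** — for EVERY edge
  list with distinct endpoints and EVERY level bijections: `P^φ(x,y) = P^1_ν(Ψx,Ψy)` with `ν_k = μ_k∘L_k⁻¹` and the
  conjugated updates, and `Gap_π̃(P^φ) = Gap_ν̃(P^1_ν)`.
* §2 **`flowGraph_dilutedHandover_le`** — for every allocation `w` and sector-idle cold replicas (in level
  coordinates): `Gap(P^φ) ≤ t·h·min{ν_0(A),ν_0(Aᶜ)}/(m·K·v)`, `ν_k(A)ν_k(Aᶜ) ≥ v` at the cold levels.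
* §3 **`flowGraphSimpleHub_spectralGap_two_sided`** — simple graph containing the hub, consistent maps with `L_0 = id`,
  hot-only updates, hot Poincaré constant `γ₀`, TRANSPORTED domination `p·μ_{k+1}(L_{k+1}⁻¹u) ≤ μ_0(u)`:
  **`p·min{t/(6m), γ₀(1−t)/(14K)} ≤ Gap(P^φ) ≤ t·min{μ_0(A), μ_0(Aᶜ)}/(m·v)`** — the dilution law with maps; the
  complete graph of composed flows is order `K⁻²`, two-sided, like the plain one.

Reading (no numerics implied): learned transports that are mutually consistent along the graph — as composed flows are
— cannot change any power of `K` or of `m`: they act on the constants (domination, overlaps) only, on every topology at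
once.  NOT CLAIMED: INCONSISTENT families (maps around a cycle composing to a non-trivial bijection), for which no
global change of coordinates exists; continuous spaces; anything measured.  Literature grade (cell rule): OWN MECHANISM
(I2/I3's conjugacy, general graph), NEW TYPING; nothing cited as a fact; no new bib keys.
-/

noncomputable section

open Finset Function
open Literature.Probability.MarkovChains

namespace Summit.Ventures.LatticeQCDFlow.Scaling

variable {S : Type*} [Fintype S] [DecidableEq S] {K m : ℕ} {μ : Fin (K + 1) → S → ℝ}
  {M : Fin (K + 1) → S → S → ℝ} {w : Fin (K + 1) → ℝ} {t : ℝ} {e : Fin m → Fin (K + 1) × Fin (K + 1)}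

section Conj
variable (L : Fin (K + 1) → Equiv.Perm S)

/-! ## §1 The level relabelling straightens every consistent map swap -/

omit [Fintype S] [DecidableEq S] in
/-- **The relabelling straightens the consistent map swap:** with `φ = L_l⁻¹∘L_i` on the edge `(i,l)` (`i ≠ l`),
`Ψ(edgeFlowSwap φ i l x) = Ψ(x) ∘ τ_{il}`, `Ψ(x)_k = L_k(x_k)`. [ours] -/
theorem levelRelabel_edgeFlowSwap {i l : Fin (K + 1)} (hil : i ≠ l) (x : Fin (K + 1) → S) :
    (fun j => L j (edgeFlowSwap ((L i).trans (L l).symm) i l x j)) = (fun j => L j (x j)) ∘ Equiv.swap i l := by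
  funext j
  simp only [Function.comp_apply]
  by_cases h1 : j = i
  · subst h1
    rw [Equiv.swap_apply_left, edgeFlowSwap_fst _ hil, Equiv.symm_trans_apply, Equiv.symm_symm,
      Equiv.apply_symm_apply]
  · by_cases h2 : j = l
    · subst h2
      rw [Equiv.swap_apply_right, edgeFlowSwap_snd, Equiv.trans_apply, Equiv.apply_symm_apply]
    · rw [Equiv.swap_apply_of_ne_of_ne h1 h2, edgeFlowSwap_of_ne _ _ _ _ h1 h2]

omit [Fintype S] in
/-- **The graph proposal with consistent maps relabels onto the graph proposal with identity maps.** [ours] -/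
theorem ptGraphProposal_levelRelabel (he : ∀ r, (e r).1 ≠ (e r).2) (x y : Fin (K + 1) → S) :
    ptGraphProposal e (fun r => (L (e r).1).trans (L (e r).2).symm) x y
      = ptGraphProposal e (fun _ : Fin m => Equiv.refl S) (fun i => L i (x i)) (fun i => L i (y i)) := by
  unfold ptGraphProposal
  refine sum_congr rfl fun r _ => ?_
  have hΨinj : Function.Injective (fun (z : Fin (K + 1) → S) (i : Fin (K + 1)) => L i (z i)) := by
    intro z z' h; funext i; exact (L i).injective (congrFun h i)
  refine if_congr ?_ rfl rfl
  rw [edgeFlowSwap_one (he r), ← levelRelabel_edgeFlowSwap L (he r) x]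
  exact ⟨fun h => by rw [h], fun h => hΨinj h⟩

/-- **THE CONJUGATION ON ANY SWAP GRAPH:** `P^φ(x,y) = P^1_ν(Ψx, Ψy)` for consistent maps `φ_r = L_{l_r}⁻¹∘L_{i_r}`.
[ours] -/
theorem flowGraph_apply_eq_conj (he : ∀ r, (e r).1 ≠ (e r).2) (t : ℝ) (w : Fin (K + 1) → ℝ)
    (x y : Fin (K + 1) → S) :
    t * ptGraphSwap μ e (fun r => (L (e r).1).trans (L (e r).2).symm) x y + (1 - t) * prodKernel w M x y
      = t * ptGraphSwap (fun i u => μ i ((L i).symm u)) e (fun _ : Fin m => Equiv.refl S)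
            (fun i => L i (x i)) (fun i => L i (y i))
        + (1 - t) * prodKernel w (fun i u v => M i ((L i).symm u) ((L i).symm v))
            (fun i => L i (x i)) (fun i => L i (y i)) := by
  congr 2
  · unfold ptGraphSwap
    exact mhKernel_conj (Equiv.piCongrRight L)
      (T := ptGraphProposal e (fun r => (L (e r).1).trans (L (e r).2).symm)) (π := tensorFun μ)
      (fun a b => ptGraphProposal_levelRelabel L he a b) (fun a => tensorFun_relabel L μ a) x y
  · exact prodKernel_conj L w M x y

/-- **THE SPECTRAL GAP WITH CONSISTENT MAPS IS THAT OF THE CONJUGATE IDENTITY-MAP SCHEME ON THE SAME GRAPH.** [ours] -/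
theorem flowGraph_spectralGap_eq (he : ∀ r, (e r).1 ≠ (e r).2) (t : ℝ) (w : Fin (K + 1) → ℝ) :
    spectralGap (tensorFun μ) (fun x y : Fin (K + 1) → S =>
        t * ptGraphSwap μ e (fun r => (L (e r).1).trans (L (e r).2).symm) x y + (1 - t) * prodKernel w M x y)
      = spectralGap (tensorFun (fun i u => μ i ((L i).symm u)))
          (fun x y : Fin (K + 1) → S =>
            t * ptGraphSwap (fun i u => μ i ((L i).symm u)) e (fun _ : Fin m => Equiv.refl S) x y
              + (1 - t) * prodKernel w (fun i u v => M i ((L i).symm u) ((L i).symm v)) x y) := by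
  refine Eq.trans ?_ (spectralGap_conj (Equiv.piCongrRight L) _ _)
  congr 1
  · funext x; exact tensorFun_relabel L μ x
  · funext x y; exact flowGraph_apply_eq_conj L he t w x y

/-! ## §2 The diluted handover ceiling with consistent maps -/

/-- **THE DILUTED HANDOVER CEILING WITH CONSISTENT MAPS:** for every allocation `w`, and cold replicas that are
sector-idle in level coordinates (`w_k·Q^L_k(A,Aᶜ) = 0` for `k ≠ 0`, `Q^L_k` the exit flow of the conjugated update
`M_k(L_k⁻¹·, L_k⁻¹·)` from `ν_k = μ_k∘L_k⁻¹`), `ν_k(A)ν_k(Aᶜ) ≥ v > 0` (`k ≠ 0`), `K, m ≥ 1`: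
**`Gap(P^φ) ≤ t·h·min{ν_0(A), ν_0(Aᶜ)}/(m·K·v)`**. [ours] -/
theorem flowGraph_dilutedHandover_le [Nontrivial S] (hK : 1 ≤ K) (hm : 1 ≤ m) (he : ∀ r, (e r).1 ≠ (e r).2)
    (hμ : ∀ k x, 0 < μ k x) (hμ1 : ∀ k, ∑ u, μ k u = 1) (hM : ∀ k, IsRowStochastic (M k))
    (hMrev : ∀ k, DetailedBalance (μ k) (M k)) (hw0 : ∀ k, 0 ≤ w k) (hw1 : ∑ k, w k = 1) (ht0 : 0 ≤ t)
    (ht1 : t ≤ 1) {A : Finset S} {v : ℝ} (hvpos : 0 < v)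
    (hv : ∀ k : Fin (K + 1), k ≠ 0 → v ≤ (∑ u ∈ A, μ k ((L k).symm u)) * ∑ u ∈ Aᶜ, μ k ((L k).symm u))
    (hidle : ∀ k : Fin (K + 1), k ≠ 0 →
      w k * edgeMeasure (fun u => μ k ((L k).symm u)) (fun u v => M k ((L k).symm u) ((L k).symm v)) A Aᶜ = 0) :
    spectralGap (tensorFun μ) (fun x y : Fin (K + 1) → S =>
        t * ptGraphSwap μ e (fun r => (L (e r).1).trans (L (e r).2).symm) x y + (1 - t) * prodKernel w M x y)
      ≤ t * ((univ.filter fun r : Fin m => (e r).1 = 0 ∨ (e r).2 = 0).card : ℝ)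
          * min (∑ u ∈ A, μ 0 ((L 0).symm u)) (∑ u ∈ Aᶜ, μ 0 ((L 0).symm u)) / (m * K * v) := by
  rw [flowGraph_spectralGap_eq L he t w]
  exact dilutedHandover_spectralGap_le (μ := fun i u => μ i ((L i).symm u))
    (M := fun i u v => M i ((L i).symm u) ((L i).symm v)) (φ := fun _ : Fin m => Equiv.refl S) hK hm he
    (fun k u => hμ k _) (fun k => by rw [Equiv.sum_comp (L k).symm (μ k)]; exact hμ1 k)
    (fun k => ⟨fun u v => (hM k).1 _ _, fun u => by
      simpa using (Equiv.sum_comp (L k).symm (fun v => M k ((L k).symm u) v)).trans ((hM k).2 _)⟩)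
    (fun k u v => hMrev k _ _) hw0 hw1 ht0 ht1 (fun _ _ => Iff.rfl) hvpos hv hidle

/-! ## §3 The dilution law with consistent maps -/

/-- **THE DILUTION LAW WITH CONSISTENT MAPS (`L_0 = id`):** a simple swap graph of `m` edges containing every hub edge,
maps `φ_r = L_{l_r}⁻¹∘L_{i_r}`, hot-only updates, hot Poincaré constant `γ₀`, transported domination
`p·μ_{k+1}(L_{k+1}⁻¹ u) ≤ μ_0(u)`, and a set `A` with `μ_k(L_k⁻¹A)·μ_k(L_k⁻¹Aᶜ) ≥ v > 0` at the cold levels: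
**`p·min{t/(6m), γ₀(1−t)/(14K)} ≤ Gap(P^φ) ≤ t·min{μ_0(A), μ_0(Aᶜ)}/(m·v)`**. [ours] -/
theorem flowGraphSimpleHub_spectralGap_two_sided [Nontrivial S] (hL0 : L 0 = Equiv.refl S) (hK : 1 ≤ K) (hm : 1 ≤ m)
    (he : ∀ r, (e r).1 ≠ (e r).2)
    (hsimple : Function.Injective (fun r => ({(e r).1, (e r).2} : Finset (Fin (K + 1)))))
    (hhub : ∀ k : Fin K, ∃ j, e j = ((0 : Fin (K + 1)), k.succ)) (hμ : ∀ k x, 0 < μ k x)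
    (hμ1 : ∀ k, ∑ u, μ k u = 1) (hM : ∀ k, IsRowStochastic (M k)) (hMrev : ∀ k, DetailedBalance (μ k) (M k))
    (ht0 : 0 < t) (ht1 : t < 1) {p γ₀ : ℝ} (hp : 0 < p) (hp1 : p ≤ 1) (hγ₀ : 0 < γ₀)
    (hdom : ∀ (k : Fin K) (u : S), p * μ k.succ ((L k.succ).symm u) ≤ μ 0 u)
    (hgap0 : ∀ g : S → ℝ, γ₀ * lawVariance (μ 0) g ≤ dirichletForm (μ 0) (M 0) g) {A : Finset S} {v : ℝ}
    (hvpos : 0 < v)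
    (hv : ∀ k : Fin (K + 1), k ≠ 0 → v ≤ (∑ u ∈ A, μ k ((L k).symm u)) * ∑ u ∈ Aᶜ, μ k ((L k).symm u)) :
    p * min (t / (6 * m)) (γ₀ * (1 - t) / (14 * K))
        ≤ spectralGap (tensorFun μ) (fun x y : Fin (K + 1) → S =>
            t * ptGraphSwap μ e (fun r => (L (e r).1).trans (L (e r).2).symm) x y
              + (1 - t) * prodKernel (fun k : Fin (K + 1) => if k = 0 then (1 : ℝ) else 0) M x y)
      ∧ spectralGap (tensorFun μ) (fun x y : Fin (K + 1) → S =>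
            t * ptGraphSwap μ e (fun r => (L (e r).1).trans (L (e r).2).symm) x y
              + (1 - t) * prodKernel (fun k : Fin (K + 1) => if k = 0 then (1 : ℝ) else 0) M x y)
          ≤ t * min (∑ u ∈ A, μ 0 u) (∑ u ∈ Aᶜ, μ 0 u) / (m * v) := by
  rw [flowGraph_spectralGap_eq L he t]
  have hL0u : ∀ u, (L 0).symm u = u := fun u => by rw [hL0]; rfl
  have hν0 : (fun u => μ 0 ((L 0).symm u)) = μ 0 := funext fun u => by rw [hL0u]
  have hM0 : (fun u v => M 0 ((L 0).symm u) ((L 0).symm v)) = M 0 := funext fun u => funext fun v => by rw [hL0u, hL0u]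
  have h := simpleHubGraph_spectralGap_two_sided (μ := fun i u => μ i ((L i).symm u))
    (M := fun i u v => M i ((L i).symm u) ((L i).symm v)) (e := e) hK hm he hsimple hhub (fun k u => hμ k _)
    (fun k => by rw [Equiv.sum_comp (L k).symm (μ k)]; exact hμ1 k)
    (fun k => ⟨fun u v => (hM k).1 _ _, fun u => by
      simpa using (Equiv.sum_comp (L k).symm (fun v => M k ((L k).symm u) v)).trans ((hM k).2 _)⟩)
    (fun k u v => hMrev k _ _) ht0 ht1 hp hp1 hγ₀ (fun k u => by simp only [hL0u]; exact hdom k u)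
    (fun g => by
      have e1 : lawVariance (fun u => μ 0 ((L 0).symm u)) g = lawVariance (μ 0) g := by rw [hν0]
      have e2 : dirichletForm (fun u => μ 0 ((L 0).symm u)) (fun u v => M 0 ((L 0).symm u) ((L 0).symm v)) g
          = dirichletForm (μ 0) (M 0) g := by rw [hν0, hM0]
      rw [e1, e2]; exact hgap0 g)
    (A := A) hvpos hv
  simp only [hL0u] at h
  exact h

end Conj

end Summit.Ventures.LatticeQCDFlow.Scaling

end
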